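import Literature.Algebra.EuclideanLattices.DiscreteGaussian
import Literature.NumberTheory.LFunctions.DedekindZetaThetaProofs
import HarnessLib

/-!
# Gaussian sums over a lattice and its dual: the shifted Poisson identity (Banaszczyk 1993 §1, Aharonov–Regev 2005 §3–4)

Topic `Algebra/EuclideanLattices` (family `pqc`; serves the decomposition of Aharonov–Regev 2005,
Thm. 1.1 / Cor. 1.2 = `gapCVP_sqrt_mem_promiseCoNP` → `Literature.Barriers.PneNP.LatticeGapCoNP`,
and pqc.S23). Everything here is PROVED, from the tree's Poisson summation formula for full
lattices in euclidean spaces (`Literature.NumberTheory.LFunctions.Fourier.tsum_eq_tsum_fourier_of_rpow_decay`,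
Neukirch VII (3.2), `DedekindZetaPoissonProofs.lean`) and Mathlib's Fourier transform of the
Gaussian (`fourier_gaussian_innerProductSpace`).

Notation: `ρ_s(x) = exp(-π‖x‖²/s²)` is `gaussianFunction s x` (`DiscreteGaussian.lean`), `L*` is
`dualLattice L` (`DualLattice.lean`), `n = finrank ℝ V`, `vol(L) = ZLattice.covolume L`.

## Results

* `fourier_gaussianFunction_sub` — `𝓕[ρ_s(· - x)](w) = e(-⟪x, w⟫) sⁿ ρ_{1/s}(w)`.
* `tsum_coe_gaussianFunction_sub_eq`, `tsum_gaussianFunction_sub_eq` — **the shifted Poisson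
  identity** `∑_{y ∈ L} ρ_s(y - x) = vol(L)⁻¹ sⁿ ∑_{w ∈ L*} ρ_{1/s}(w) cos(2π⟪x, w⟫)` (complex and
  real forms), and at the origin `ρ_s(L) = vol(L)⁻¹ sⁿ ρ_{1/s}(L*)` (`tsum_gaussianFunction_eq`);
  this is Banaszczyk 1993, Lemma 1.1 (i) / the computation of Aharonov–Regev 2005, Claim 4.1
  ("the Fourier series of `f` is `e^{-π‖w‖²}/∑_{z ∈ L*} e^{-π‖z‖²}`").
* `tsum_gaussianFunction_sub_div_eq` — **Aharonov–Regev's `f` as a cosine average over the dual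
  discrete Gaussian**: `ρ_s(L - x)/ρ_s(L) = (∑_{w ∈ L*} ρ_{1/s}(w) cos(2π⟪x, w⟫)) / ρ_{1/s}(L*)`
  (AR05, proof of Lemma 1.3, first display: `f(x) = E_{w ∼ f̂}[cos(2π⟨w, x⟩)]`).
* `tsum_gaussianFunction_sub_le` — `ρ_s(L - x) ≤ ρ_s(L)` (Banaszczyk 1993, Lemma 1.1 consequence);
  `tsum_gaussianFunction_sub_le_pow_mul` — `ρ_{ts}(L - x) ≤ tⁿ ρ_s(L)` for `t ≥ 1`.
* `gaussianFunction_mul_tsum_le` — **Aharonov–Regev 2005, Lemma 3.2 (its inequality)**: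
  `ρ_s(L - x) ≥ ρ_s(x) ρ_s(L)` ("`f(x) ≥ e^{-π‖x‖²}`", by pairing `±y`, `e^{a} + e^{-a} ≥ 2`).
* The sequel `GaussianLatticeTails.lean` derives Banaszczyk's tail bound (Lemma 1.5),
  Aharonov–Regev's Lemma 3.1 and the discharges of `gaussianMass_diff_ball_le_pow_mul` /
  `gaussianMass_diff_ball_le` (`PQCDiscreteGaussian.lean`) from these.

## Proofs

Banaszczyk's argument as streamlined by Micciancio–Regev / Aharonov–Regev, all from the one
Poisson identity: its dual side has nonnegative coefficients, so (i) replacing `cos` by `1`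
bounds the shifted sum by the centred one, and (ii) the dual coefficients `ρ_{1/s}` are monotone
in `s`, giving `ρ_{ts}(L - x) ≤ tⁿ ρ_s(L)`. The Poisson formula needs the decay
`ρ_s(v - x) ≤ e^{b²s²/(4π)} (1 + ‖x‖)ᵇ (1 + ‖v‖)⁻ᵇ` (`norm_coe_gaussianFunction_sub_le`) and the
summability of Gaussians over lattices (`summable_gaussianFunction_sub`, `DiscreteGaussian.lean`).
The import of `DedekindZetaThetaProofs` (for the Poisson formula and the Gaussian-vs-powers
inequality `exp_neg_mul_sq_le`) is heavier than the mathematics requires; a librarian may move the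
Poisson formula to `Analysis/`.

## What is NOT here

Banaszczyk's Lemma 1.3 (second moments, Aharonov–Regev Lemma 2.6), the Chernoff–Hoeffding /
second-moment sampling arguments (AR05 Lemma 1.3, Lemma 6.2) and everything machine-level: these
are later files of the decomposition (see the provefact notes of `LatticeGapCoNP`).

## References

* W. Banaszczyk, *New bounds in some transference theorems in the geometry of numbers*,
  Math. Ann. 296 (1993) 625–635, Lemma 1.1, Lemma 1.5.
* D. Aharonov, O. Regev, *Lattice problems in NP ∩ coNP*, J. ACM 52 (2005) 749–765, Lemmas 2.5,
  3.1, 3.2, Claim 4.1 (pp. 7–9 of the preprint, `lit read paper:doi-10-1109-focs-2004-35`).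
* J. Neukirch, *Algebraic Number Theory*, Springer 1999, Ch. VII (3.2) (Poisson summation).
-/

noncomputable section

open MeasureTheory Complex Module
open scoped Real FourierTransform InnerProductSpace ENNReal

namespace Literature.Algebra.EuclideanLattices

/-- The Gaussian as a complex exponential. [folklore] -/
theorem coe_gaussianFunction_eq_cexp {E : Type*} [NormedAddCommGroup E] (s : ℝ) (v : E) :
    ((gaussianFunction s v : ℝ) : ℂ) = cexp (-((π / s ^ 2 : ℝ) : ℂ) * (‖v‖ : ℂ) ^ 2) := by
  rw [gaussianFunction, Complex.ofReal_exp]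
  congr 1
  push_cast
  ring

variable {V : Type*} [NormedAddCommGroup V] [InnerProductSpace ℝ V] [FiniteDimensional ℝ V]
  [MeasurableSpace V] [BorelSpace V]

/-- The Fourier transform of the shifted Gaussian `v ↦ ρ_s(v - x)`:
`𝓕[ρ_s(· - x)](w) = e(-⟪x, w⟫) sⁿ ρ_{1/s}(w)` (Mathlib's `fourier_gaussian_innerProductSpace` and the
translation rule `VectorFourier.fourierIntegral_comp_add_right`). [folklore] -/
theorem fourier_gaussianFunction_sub {s : ℝ} (hs : 0 < s) (x w : V) :
    𝓕 (fun v : V ↦ ((gaussianFunction s (v - x) : ℝ) : ℂ)) w =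
      𝐞 (-⟪x, w⟫_ℝ) • (((s ^ finrank ℝ V * gaussianFunction s⁻¹ w : ℝ)) : ℂ) := by
  set b : ℝ := π / s ^ 2 with hb
  have hbpos : 0 < b := by positivity
  have hbre : 0 < ((b : ℂ)).re := by simpa using hbpos
  set G : V → ℂ := fun v ↦ cexp (-(b : ℂ) * (‖v‖ : ℂ) ^ 2) with hG
  have hF : (fun v : V ↦ ((gaussianFunction s (v - x) : ℝ) : ℂ)) = G ∘ fun v ↦ v + -x := by
    funext v
    simp only [Function.comp_apply, hG, coe_gaussianFunction_eq_cexp, ← sub_eq_add_neg, hb]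
  rw [hF]
  have key := VectorFourier.fourierIntegral_comp_add_right 𝐞 (volume : Measure V) (innerₗ V) G (-x)
  change VectorFourier.fourierIntegral 𝐞 volume (innerₗ V) (G ∘ fun v ↦ v + -x) w = _
  rw [key]
  simp only [innerₗ_apply_apply, inner_neg_left]
  congr 1
  change 𝓕 G w = _
  rw [hG, fourier_gaussian_innerProductSpace hbre w]
  -- `(π / b) ^ (n/2) = s ^ n` and `exp (-π² ‖w‖² / b) = ρ_{1/s}(w)`
  have hπb : (π : ℂ) / (b : ℂ) = ((s ^ 2 : ℝ) : ℂ) := by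
    rw [hb]
    push_cast
    field_simp
  have hpow : ((π : ℂ) / (b : ℂ)) ^ ((finrank ℝ V : ℂ) / 2) = ((s ^ finrank ℝ V : ℝ) : ℂ) := by
    rw [hπb, show ((finrank ℝ V : ℂ) / 2) = (((finrank ℝ V : ℝ) / 2 : ℝ) : ℂ) by push_cast; ring,
      ← Complex.ofReal_cpow (by positivity)]
    congr 1
    rw [show (s ^ 2 : ℝ) = s ^ (2 : ℝ) by norm_cast, ← Real.rpow_mul hs.le]
    rw [show (2 : ℝ) * ((finrank ℝ V : ℝ) / 2) = (finrank ℝ V : ℝ) by ring, Real.rpow_natCast]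
  have hexp : cexp (-(π : ℂ) ^ 2 * (‖w‖ : ℂ) ^ 2 / (b : ℂ)) = ((gaussianFunction s⁻¹ w : ℝ) : ℂ) := by
    rw [gaussianFunction, Complex.ofReal_exp]
    congr 1
    rw [hb]
    push_cast
    field_simp
  rw [hpow, hexp]
  push_cast
  ring

omit [InnerProductSpace ℝ V] [FiniteDimensional ℝ V] [MeasurableSpace V] [BorelSpace V] in
/-- Decay of the shifted Gaussian against powers of `1 + ‖v‖`:
`ρ_s(v - x) ≤ e^{b² s²/(4π)} (1 + ‖x‖)ᵇ (1 + ‖v‖)⁻ᵇ`. [folklore] -/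
theorem norm_coe_gaussianFunction_sub_le {s : ℝ} (hs : 0 < s) (x : V) {b : ℝ} (hb : 0 ≤ b) (v : V) :
    ‖((gaussianFunction s (v - x) : ℝ) : ℂ)‖ ≤
      Real.exp (b ^ 2 / (4 * (π / s ^ 2))) * (1 + ‖x‖) ^ b * (1 + ‖v‖) ^ (-b) := by
  rw [Complex.norm_real, Real.norm_eq_abs, abs_of_pos (gaussianFunction_pos s _), gaussianFunction]
  have ha : 0 < π / s ^ 2 := by positivity
  have h1 := Literature.NumberTheory.LFunctions.NumberField.exp_neg_mul_sq_le ha hb (norm_nonneg (v - x))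
  have h1' : Real.exp (-π * ‖v - x‖ ^ 2 / s ^ 2) ≤
      Real.exp (b ^ 2 / (4 * (π / s ^ 2))) * (1 + ‖v - x‖) ^ (-b) := by
    have : -π * ‖v - x‖ ^ 2 / s ^ 2 = -(π / s ^ 2) * ‖v - x‖ ^ 2 := by ring
    rwa [this]
  -- `(1 + ‖v - x‖)⁻ᵇ ≤ (1 + ‖x‖)ᵇ (1 + ‖v‖)⁻ᵇ` since `1 + ‖v‖ ≤ (1 + ‖v - x‖)(1 + ‖x‖)`
  have hvx : 1 + ‖v‖ ≤ (1 + ‖v - x‖) * (1 + ‖x‖) := by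
    have := norm_le_norm_sub_add v x   -- ‖v‖ ≤ ‖v - x‖ + ‖x‖
    nlinarith [norm_nonneg (v - x), norm_nonneg x]
  have h2 : (1 + ‖v - x‖) ^ (-b) ≤ (1 + ‖x‖) ^ b * (1 + ‖v‖) ^ (-b) := by
    have hpow : (1 + ‖v‖) ^ b ≤ (1 + ‖v - x‖) ^ b * (1 + ‖x‖) ^ b := by
      rw [← Real.mul_rpow (by positivity) (by positivity)]
      exact Real.rpow_le_rpow (by positivity) hvx hb
    rw [Real.rpow_neg (by positivity), Real.rpow_neg (by positivity)]
    have hne : (1 + ‖x‖) ^ b ≠ 0 := by positivity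
    rw [show ((1 + ‖v - x‖) ^ b)⁻¹ = (1 + ‖x‖) ^ b * ((1 + ‖v - x‖) ^ b * (1 + ‖x‖) ^ b)⁻¹ by
      field_simp]
    exact mul_le_mul_of_nonneg_left (inv_anti₀ (by positivity) hpow) (by positivity)
  calc Real.exp (-π * ‖v - x‖ ^ 2 / s ^ 2)
      ≤ Real.exp (b ^ 2 / (4 * (π / s ^ 2))) * (1 + ‖v - x‖) ^ (-b) := h1'
    _ ≤ Real.exp (b ^ 2 / (4 * (π / s ^ 2))) * ((1 + ‖x‖) ^ b * (1 + ‖v‖) ^ (-b)) := by gcongr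
    _ = _ := by ring

variable (L : Submodule ℤ V) [DiscreteTopology L] [IsZLattice ℝ L]

/-- **The shifted Poisson identity for Gaussians, complex form**: for a full lattice `L`, `s > 0`
and `x ∈ V`, `∑_{y ∈ L} ρ_s(y - x) = vol(L)⁻¹ sⁿ ∑_{w ∈ L*} e(-⟪x, w⟫) ρ_{1/s}(w)` (Poisson summation,
Neukirch VII (3.2), applied to `ρ_s(· - x)`; Banaszczyk 1993, Lemma 1.1(i)).
[cite: Banaszczyk1993, Lemma 1.1] -/
theorem tsum_coe_gaussianFunction_sub_eq {s : ℝ} (hs : 0 < s) (x : V) :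
    ∑' y : L, ((gaussianFunction s ((y : V) - x) : ℝ) : ℂ) =
      ((ZLattice.covolume L)⁻¹ : ℝ) • ∑' w : dualLattice L,
        𝐞 (-⟪x, (w : V)⟫_ℝ) • (((s ^ finrank ℝ V * gaussianFunction s⁻¹ (w : V) : ℝ)) : ℂ) := by
  have hb : (finrank ℝ V : ℝ) < (finrank ℝ V : ℝ) + 1 := by linarith
  have hb0 : (0 : ℝ) ≤ (finrank ℝ V : ℝ) + 1 := by positivity
  have hcont : Continuous fun v : V ↦ ((gaussianFunction s (v - x) : ℝ) : ℂ) := by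
    unfold gaussianFunction; fun_prop
  have hdec := fun v ↦ norm_coe_gaussianFunction_sub_le hs x hb0 v
  have hsum : Summable fun w : dualLattice L ↦
      𝓕 (fun v : V ↦ ((gaussianFunction s (v - x) : ℝ) : ℂ)) (w : V) := by
    simp_rw [fourier_gaussianFunction_sub hs x]
    refine Summable.of_norm ?_
    have hS := (summable_gaussianFunction_sub (dualLattice L) (inv_ne_zero hs.ne') (0 : V)).mul_left
      (s ^ finrank ℝ V)
    refine hS.congr fun w ↦ ?_
    rw [Circle.norm_smul, Complex.norm_real, Real.norm_eq_abs, sub_zero,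
      abs_of_pos (mul_pos (pow_pos hs _) (gaussianFunction_pos _ _))]
  have key := Literature.NumberTheory.LFunctions.Fourier.tsum_eq_tsum_fourier_of_rpow_decay L hcont hb
    hdec hsum
  rw [key]
  congr 1
  exact tsum_congr fun w ↦ fourier_gaussianFunction_sub hs x w

/-- **The shifted Poisson identity for Gaussians** (real form): for a full lattice `L`, `s > 0` and
`x ∈ V`, `∑_{y ∈ L} ρ_s(y - x) = vol(L)⁻¹ sⁿ ∑_{w ∈ L*} ρ_{1/s}(w) cos(2π⟪x, w⟫)` (the real part of
the complex form; Banaszczyk 1993, Lemma 1.1(i); Aharonov–Regev 2005, Claim 4.1 with Fact 2.3).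
[cite: Banaszczyk1993, Lemma 1.1] -/
theorem tsum_gaussianFunction_sub_eq {s : ℝ} (hs : 0 < s) (x : V) :
    ∑' y : L, gaussianFunction s ((y : V) - x) =
      (ZLattice.covolume L)⁻¹ * s ^ finrank ℝ V *
        ∑' w : dualLattice L, gaussianFunction s⁻¹ (w : V) * Real.cos (2 * π * ⟪x, (w : V)⟫_ℝ) := by
  have h := congrArg Complex.re (tsum_coe_gaussianFunction_sub_eq L hs x)
  rw [← Complex.ofReal_tsum, Complex.ofReal_re, Complex.smul_re] at h
  have hsumC : Summable fun w : dualLattice L ↦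
      𝐞 (-⟪x, (w : V)⟫_ℝ) • (((s ^ finrank ℝ V * gaussianFunction s⁻¹ (w : V) : ℝ)) : ℂ) := by
    refine Summable.of_norm ?_
    have hS := (summable_gaussianFunction_sub (dualLattice L) (inv_ne_zero hs.ne') (0 : V)).mul_left
      (s ^ finrank ℝ V)
    refine hS.congr fun w ↦ ?_
    rw [Circle.norm_smul, Complex.norm_real, Real.norm_eq_abs, sub_zero,
      abs_of_pos (mul_pos (pow_pos hs _) (gaussianFunction_pos _ _))]
  rw [Complex.re_tsum hsumC] at h
  rw [h, mul_assoc, ← tsum_mul_left]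
  congr 1
  refine tsum_congr fun w ↦ ?_
  rw [Circle.smul_def, Real.fourierChar_apply, smul_eq_mul, mul_comm, Complex.re_ofReal_mul,
    Complex.exp_ofReal_mul_I_re, show 2 * π * -⟪x, (w : V)⟫_ℝ = -(2 * π * ⟪x, (w : V)⟫_ℝ) by ring,
    Real.cos_neg]
  ring

omit [MeasurableSpace V] [BorelSpace V] in
/-- Summability of the cosine-weighted Gaussian over a lattice. [folklore] -/
theorem summable_gaussianFunction_mul_cos (Λ : Submodule ℤ V) [DiscreteTopology Λ] {s : ℝ} (hs : s ≠ 0)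
    (x : V) : Summable fun w : Λ ↦ gaussianFunction s (w : V) * Real.cos (2 * π * ⟪x, (w : V)⟫_ℝ) := by
  refine Summable.of_norm_bounded ((summable_gaussianFunction_sub Λ hs (0 : V)).congr fun w ↦ by
    rw [sub_zero]) fun w ↦ ?_
  rw [Real.norm_eq_abs, abs_mul, abs_of_pos (gaussianFunction_pos _ _)]
  exact mul_le_of_le_one_right (gaussianFunction_pos _ _).le (Real.abs_cos_le_one _)

/-- **Poisson identity for Gaussians at the origin**: `ρ_s(L) = vol(L)⁻¹ sⁿ ρ_{1/s}(L*)`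
(Banaszczyk 1993, Lemma 1.1(i) at `u = 0`; the theta transformation formula).
[cite: Banaszczyk1993, Lemma 1.1] -/
theorem tsum_gaussianFunction_eq {s : ℝ} (hs : 0 < s) :
    ∑' y : L, gaussianFunction s (y : V) =
      (ZLattice.covolume L)⁻¹ * s ^ finrank ℝ V * ∑' w : dualLattice L, gaussianFunction s⁻¹ (w : V) := by
  have h := tsum_gaussianFunction_sub_eq L hs 0
  simp only [sub_zero, inner_zero_left, mul_zero, Real.cos_zero, mul_one] at h
  exact h

omit [MeasurableSpace V] [BorelSpace V] in
/-- The Gaussian sum over a lattice is positive. [folklore] -/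
theorem tsum_gaussianFunction_sub_pos (Λ : Submodule ℤ V) [DiscreteTopology Λ] {s : ℝ} (hs : s ≠ 0)
    (x : V) : 0 < ∑' y : Λ, gaussianFunction s ((y : V) - x) :=
  (summable_gaussianFunction_sub Λ hs x).tsum_pos (fun _ ↦ (gaussianFunction_pos _ _).le) 0
    (gaussianFunction_pos _ _)

/-- **A shift never increases the Gaussian mass of a lattice**: `ρ_s(L - x) ≤ ρ_s(L)`
(Banaszczyk 1993, Lemma 1.1(i): immediate from the Poisson identity, whose dual side has
nonnegative coefficients and `cos ≤ 1`). [cite: Banaszczyk1993, Lemma 1.1] -/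
theorem tsum_gaussianFunction_sub_le {s : ℝ} (hs : 0 < s) (x : V) :
    ∑' y : L, gaussianFunction s ((y : V) - x) ≤ ∑' y : L, gaussianFunction s (y : V) := by
  rw [tsum_gaussianFunction_sub_eq L hs x, tsum_gaussianFunction_eq L hs]
  have hc : 0 ≤ (ZLattice.covolume L)⁻¹ * s ^ finrank ℝ V :=
    mul_nonneg (inv_nonneg.2 (ZLattice.covolume_pos L volume).le) (pow_nonneg hs.le _)
  refine mul_le_mul_of_nonneg_left ?_ hc
  refine Summable.tsum_le_tsum (fun w ↦ ?_) (summable_gaussianFunction_mul_cos _ (inv_ne_zero hs.ne') x)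
    ((summable_gaussianFunction_sub (dualLattice L) (inv_ne_zero hs.ne') (0 : V)).congr fun w ↦ by
      rw [sub_zero])
  exact mul_le_of_le_one_right (gaussianFunction_pos _ _).le (Real.cos_le_one _)

/-- **Scaling up the parameter**: for `s > 0` and `t ≥ 1`, `ρ_{ts}(L - x) ≤ tⁿ ρ_s(L)`
(Banaszczyk 1993, proof of Lemma 1.5: the dual side of the Poisson identity is monotone in the
parameter). [cite: Banaszczyk1993, Lemma 1.5 (proof)] -/
theorem tsum_gaussianFunction_sub_le_pow_mul {s t : ℝ} (hs : 0 < s) (ht : 1 ≤ t) (x : V) :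
    ∑' y : L, gaussianFunction (t * s) ((y : V) - x) ≤ t ^ finrank ℝ V * ∑' y : L, gaussianFunction s (y : V) := by
  have ht0 : 0 < t := one_pos.trans_le ht
  have hts : 0 < t * s := mul_pos ht0 hs
  refine (tsum_gaussianFunction_sub_le L hts x).trans ?_
  rw [tsum_gaussianFunction_eq L hts, tsum_gaussianFunction_eq L hs, mul_pow]
  have hle : (t * s)⁻¹ ≤ s⁻¹ := by
    rw [mul_inv]
    exact mul_le_of_le_one_left (inv_nonneg.2 hs.le) (inv_le_one_of_one_le₀ ht)
  have hAB : ∑' w : dualLattice L, gaussianFunction (t * s)⁻¹ (w : V) ≤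
      ∑' w : dualLattice L, gaussianFunction s⁻¹ (w : V) :=
    Summable.tsum_le_tsum (fun w ↦ gaussianFunction_mono_left (inv_pos.2 hts) hle _)
      ((summable_gaussianFunction_sub (dualLattice L) (inv_ne_zero hts.ne') (0 : V)).congr fun w ↦ by
        rw [sub_zero])
      ((summable_gaussianFunction_sub (dualLattice L) (inv_ne_zero hs.ne') (0 : V)).congr fun w ↦ by
        rw [sub_zero])
  have hc : 0 ≤ (ZLattice.covolume L)⁻¹ := inv_nonneg.2 (ZLattice.covolume_pos L volume).le
  calc (ZLattice.covolume L)⁻¹ * (t ^ finrank ℝ V * s ^ finrank ℝ V) *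
        ∑' w : dualLattice L, gaussianFunction (t * s)⁻¹ (w : V)
      = t ^ finrank ℝ V * ((ZLattice.covolume L)⁻¹ * s ^ finrank ℝ V *
          ∑' w : dualLattice L, gaussianFunction (t * s)⁻¹ (w : V)) := by ring
    _ ≤ t ^ finrank ℝ V * ((ZLattice.covolume L)⁻¹ * s ^ finrank ℝ V *
          ∑' w : dualLattice L, gaussianFunction s⁻¹ (w : V)) := by
        have hsn : 0 ≤ s ^ finrank ℝ V := pow_nonneg hs.le _
        gcongr

/-- **The ratio `ρ_s(L - x)/ρ_s(L)` as a cosine average over the dual discrete Gaussian**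
(Aharonov–Regev 2005, Claim 4.1 and the first display of the proof of Lemma 1.3:
`f(x) = ∑_{w ∈ L*} f̂(w) cos(2π⟨w, x⟩)`, `f̂ = D_{L*}`), here for every parameter `s > 0` with the
dual Gaussian `ρ_{1/s}`. [cite: AharonovRegev2005, Claim 4.1 and proof of Lemma 1.3 (pp. 9–10)] -/
theorem tsum_gaussianFunction_sub_div_eq {s : ℝ} (hs : 0 < s) (x : V) :
    (∑' y : L, gaussianFunction s ((y : V) - x)) / (∑' y : L, gaussianFunction s (y : V)) =
      (∑' w : dualLattice L, gaussianFunction s⁻¹ (w : V) * Real.cos (2 * π * ⟪x, (w : V)⟫_ℝ)) /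
        ∑' w : dualLattice L, gaussianFunction s⁻¹ (w : V) := by
  rw [tsum_gaussianFunction_sub_eq L hs x, tsum_gaussianFunction_eq L hs]
  have hc : (ZLattice.covolume L)⁻¹ * s ^ finrank ℝ V ≠ 0 :=
    mul_ne_zero (inv_ne_zero (ZLattice.covolume_pos L volume).ne') (pow_ne_zero _ hs.ne')
  rw [mul_div_mul_left _ _ hc]

/-! ### The lower bound `ρ_s(L - x) ≥ ρ_s(x) ρ_s(L)` (Aharonov–Regev Lemma 3.2) -/

omit [InnerProductSpace ℝ V] [FiniteDimensional ℝ V] [MeasurableSpace V] [BorelSpace V] in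
/-- Pairing `y` with `-y`: `ρ_s(y - x) + ρ_s(y + x) ≥ 2 ρ_s(x) ρ_s(y)` in an inner product space
(`e^{a} + e^{-a} ≥ 2`). [cite: AharonovRegev2005, Lemma 3.2 (proof, p. 9)] -/
theorem two_mul_gaussianFunction_mul_le {W : Type*} [NormedAddCommGroup W] [InnerProductSpace ℝ W]
    (s : ℝ) (x y : W) :
    2 * (gaussianFunction s x * gaussianFunction s y) ≤ gaussianFunction s (y - x) + gaussianFunction s (y + x) := by
  have hsub : ‖y - x‖ ^ 2 = ‖y‖ ^ 2 - 2 * ⟪y, x⟫_ℝ + ‖x‖ ^ 2 := norm_sub_sq_real y x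
  have hadd : ‖y + x‖ ^ 2 = ‖y‖ ^ 2 + 2 * ⟪y, x⟫_ℝ + ‖x‖ ^ 2 := norm_add_sq_real y x
  have hprod : gaussianFunction s x * gaussianFunction s y =
      Real.exp (-π * ‖x‖ ^ 2 / s ^ 2 + -π * ‖y‖ ^ 2 / s ^ 2) := by
    simp only [gaussianFunction, ← Real.exp_add]
  have hu : gaussianFunction s (y - x) =
      Real.exp (-π * ‖x‖ ^ 2 / s ^ 2 + -π * ‖y‖ ^ 2 / s ^ 2) * Real.exp (2 * π * ⟪y, x⟫_ℝ / s ^ 2) := by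
    simp only [gaussianFunction, ← Real.exp_add, hsub]
    congr 1
    ring
  have hv : gaussianFunction s (y + x) =
      Real.exp (-π * ‖x‖ ^ 2 / s ^ 2 + -π * ‖y‖ ^ 2 / s ^ 2) * Real.exp (-(2 * π * ⟪y, x⟫_ℝ / s ^ 2)) := by
    simp only [gaussianFunction, ← Real.exp_add, hadd]
    congr 1
    ring
  rw [hprod, hu, hv, ← mul_add]
  have h2 : 2 ≤ Real.exp (2 * π * ⟪y, x⟫_ℝ / s ^ 2) + Real.exp (-(2 * π * ⟪y, x⟫_ℝ / s ^ 2)) := by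
    have h₁ := Real.add_one_le_exp (2 * π * ⟪y, x⟫_ℝ / s ^ 2)
    have h₂ := Real.add_one_le_exp (-(2 * π * ⟪y, x⟫_ℝ / s ^ 2))
    linarith
  have hA0 := Real.exp_pos (-π * ‖x‖ ^ 2 / s ^ 2 + -π * ‖y‖ ^ 2 / s ^ 2)
  nlinarith

omit [MeasurableSpace V] [BorelSpace V] in
/-- **Aharonov–Regev 2005, Lemma 3.2 (the inequality behind it)**: `ρ_s(L - x) ≥ ρ_s(x) ρ_s(L)`
for every `x` — "for any `x ∈ ℝⁿ`, `f(x) ≥ e^{-π‖x‖²}`" (p. 9), by pairing `y` with `-y`.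
[cite: AharonovRegev2005, Lemma 3.2 (proof, p. 9)] -/
theorem gaussianFunction_mul_tsum_le (Λ : Submodule ℤ V) [DiscreteTopology Λ] {s : ℝ} (hs : s ≠ 0) (x : V) :
    gaussianFunction s x * ∑' y : Λ, gaussianFunction s (y : V) ≤ ∑' y : Λ, gaussianFunction s ((y : V) - x) := by
  have hS := summable_gaussianFunction_sub Λ hs x
  have hS' : Summable fun y : Λ ↦ gaussianFunction s ((y : V) + x) := by
    have := summable_gaussianFunction_sub Λ hs (-x)
    simpa [sub_neg_eq_add] using this
  have hS0 : Summable fun y : Λ ↦ gaussianFunction s (y : V) :=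
    (summable_gaussianFunction_sub Λ hs 0).congr fun y ↦ by rw [sub_zero]
  -- reindex by `y ↦ -y`
  have hneg : ∑' y : Λ, gaussianFunction s ((y : V) + x) = ∑' y : Λ, gaussianFunction s ((y : V) - x) := by
    rw [← (Equiv.neg Λ).tsum_eq]
    refine tsum_congr fun y ↦ ?_
    rw [Equiv.neg_apply, Submodule.coe_neg, ← gaussianFunction_neg s ((-(y : V)) + x)]
    congr 1
    abel
  have h2 : 2 * (gaussianFunction s x * ∑' y : Λ, gaussianFunction s (y : V)) ≤
      2 * ∑' y : Λ, gaussianFunction s ((y : V) - x) := by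
    calc 2 * (gaussianFunction s x * ∑' y : Λ, gaussianFunction s (y : V))
        = ∑' y : Λ, 2 * (gaussianFunction s x * gaussianFunction s (y : V)) := by
          rw [← tsum_mul_left, ← tsum_mul_left]
      _ ≤ ∑' y : Λ, (gaussianFunction s ((y : V) - x) + gaussianFunction s ((y : V) + x)) :=
          Summable.tsum_le_tsum (fun y ↦ two_mul_gaussianFunction_mul_le s x _) ((hS0.mul_left _).mul_left 2)
            (hS.add hS')
      _ = 2 * ∑' y : Λ, gaussianFunction s ((y : V) - x) := by
          rw [hS.tsum_add hS', hneg, two_mul]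
  linarith

end Literature.Algebra.EuclideanLattices

end
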